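import Summits.AtomisticToContinuum.FouriersLaw.Theorems.VanishingNoiseTransferNoisyFourierThomsonWitnessMoments

/-!
# Gibbs local moments for the Thomson witness, II: uniform local monomial moments and the three numbers
# (crux `VanishingNoiseTransfer.NoisyFourier`, stmt-AtomisticToContinuum-11977, line `abel-storage-decay`,
# stub B `stub_bulkAbelGKPositivity`; part W4 "GibbsLocalMoments" of lead c7's Thomson-witness project)

`--supports stmt-AtomisticToContinuum-11977` file, sequel of `…ThomsonWitnessMoments` (same setting: `P = pinnedChain ω₂ lam β γ`,
`ω₂ > 0`, `lam, β ≥ 0`, `T > 0`, `μ_T = P.gibbsMeasure L T`; `E_{≤i} = HardTether.leftEnergy P L i` the left block energies).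

* (M2) `L`-UNIFORM local monomial moments: for every exponent bound `D` one constant `C` bounds
  `∫ ∏_a |p_{k_a}|^{e_a} ∏_b |q_{k'_b}|^{e'_b} dμ_T` for all lengths `L`, all sites (repetitions allowed) and all exponents `≤ D`
  (`exists_integral_absMonomial_le`; pointwise `XY ≤ X² + Y²`, AM–GM through the maximum `∏_a w_a ≤ 1 + Σ_a w_a^r`,
  `|y|^m ≤ 1 + y^{2n}`, and the uniform even one-site moments of part I); explicit six-factor / `2+2` / `1+3` forms
  (`exists_integral_absMonomial₆_le`, `…₂₂_le`, `…₁₃_le`) and `L²(μ_T)` membership (`memLp_two_absMonomial₆`).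
* (M4) the three numbers of the project, `i0 = 0`, `iL = L − 1`, `L ≥ 2`: `∫ (p_{i0}² − p_{iL}²)² dμ_T = 4T²`
  (`integral_sq_sub_sq_sq`: `3T² − 2T² + 3T²`); for every genuine bond `i` (`i + 1 < L`) `∫ E_{≤i} (p_{i0}² − p_{iL}²) dμ_T = T²`
  (`integral_leftEnergy_mul_sq_sub_sq`: `E_{≤i} = p_0²/2 + W` with `W` independent of `p_0, p_{L−1}`, Gaussian recursion of
  part I); summed over the `L − 1` genuine bonds `∫ (Σ_{i+1<L} E_{≤i}) (p_{i0}² − p_{iL}²) dμ_T = (L − 1)T²`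
  (`integral_blockEnergySum_mul_sq_sub_sq`).
* Registered helpers `helper_thomsonMomentsAbsMonomial` (M2), `helper_thomsonMomentsPatternSq`, `helper_thomsonMomentsBondPairing`,
  `helper_thomsonMomentsBlockPairing` (M4 a, b, c).

References: folklore (Gaussian calculus). No definitions; axioms `propext`, `Classical.choice`, `Quot.sound` only.
-/

noncomputable section

open MeasureTheory
open Literature.MathematicalPhysics.KineticTheory.HeatConduction
open Literature.MathematicalPhysics.KineticTheory.HeatConduction.HardTether (leftEnergy blockWeight)
open Summit.AtomisticToContinuum.FouriersLaw.Theorems.ChainVariation (pinnedChain_abs_momentum_pow_le_all)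
open Summit.AtomisticToContinuum.FouriersLaw.Theorems.VanishingNoiseBound (contDiff_leftEnergy' leftEnergy_mem_Icc)

namespace Summit.AtomisticToContinuum.FouriersLaw.Theorems.NoisyFourier.ThomsonWitness.Moments

variable {ω₂ lam β : ℝ}

/-! ### Elementary pointwise facts -/

/-- AM–GM through the maximum: for nonnegative `w`, `∏_a w_a ≤ 1 + ∑_a w_a^r` (`r` factors). [folklore] -/
theorem prod_le_one_add_sum_pow {r : ℕ} (w : Fin r → ℝ) (hw : ∀ a, 0 ≤ w a) :
    ∏ a, w a ≤ 1 + ∑ a, w a ^ r := by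
  have hs : 0 ≤ ∑ a, w a ^ r := Finset.sum_nonneg fun a _ => pow_nonneg (hw a) r
  rcases Nat.eq_zero_or_pos r with hr | hr
  · subst hr
    simp
  · haveI : Nonempty (Fin r) := ⟨⟨0, hr⟩⟩
    obtain ⟨a₀, -, ha₀⟩ := Finset.exists_max_image Finset.univ w Finset.univ_nonempty
    calc ∏ a, w a ≤ ∏ _a : Fin r, w a₀ := Finset.prod_le_prod (fun a _ => hw a) fun a _ => ha₀ a (Finset.mem_univ a)
      _ = w a₀ ^ r := by rw [Finset.prod_const, Finset.card_univ, Fintype.card_fin]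
      _ ≤ ∑ a, w a ^ r :=
          Finset.single_le_sum (f := fun a => w a ^ r) (fun a _ => pow_nonneg (hw a) r) (Finset.mem_univ a₀)
      _ ≤ 1 + ∑ a, w a ^ r := by linarith

/-- A monomial in `r` absolute powers with exponents `≤ D` is dominated by one-site EVEN powers:
`∏_a |z_a|^{e_a} ≤ 1 + ∑_a (1 + z_a^{2Dr})`. [folklore] -/
theorem absMonomial_le {r D : ℕ} (z : Fin r → ℝ) (e : Fin r → ℕ) (he : ∀ a, e a ≤ D) :
    ∏ a, |z a| ^ e a ≤ 1 + ∑ a, (1 + z a ^ (2 * (D * r))) := by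
  have h1 := prod_le_one_add_sum_pow (fun a => |z a| ^ e a) fun a => by positivity
  refine h1.trans (add_le_add le_rfl (Finset.sum_le_sum fun a _ => ?_))
  rw [← pow_mul]
  have h2 : e a * r ≤ D * r := Nat.mul_le_mul_right r (he a)
  exact abs_pow_le_one_add_pow (h2.trans (Nat.le_mul_of_pos_left _ Nat.two_pos)) _

/-- Updating one momentum changes the block energy `E_{≤i}` only through its kinetic term:
`E_{≤i}(q, p[b ↦ t]) = E_{≤i}(q, p) + [b ≤ i](t² − p_b²)/2`. [folklore] -/
theorem leftEnergy_update_snd (P : OscillatorChain) {L : ℕ} (i b : Fin L) (x : PhaseSpace L) (t : ℝ) :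
    leftEnergy P L i (x.1, Function.update x.2 b t) =
      leftEnergy P L i x + blockWeight i b * (t ^ 2 - x.2 b ^ 2) / 2 := by
  unfold leftEnergy
  have h : ∀ k : Fin L, blockWeight i k * (Function.update x.2 b t k ^ 2 / 2 + P.U (x.1 k)) =
      blockWeight i k * (x.2 k ^ 2 / 2 + P.U (x.1 k)) +
        (if k = b then blockWeight i b * (t ^ 2 - x.2 b ^ 2) / 2 else 0) := by
    intro k
    by_cases hkb : k = b
    · subst hkb
      simp only [Function.update_self, if_true]
      ring
    · simp only [Function.update_of_ne hkb, if_neg hkb, add_zero]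
  simp only [h, Finset.sum_add_distrib, Finset.sum_ite_eq', Finset.mem_univ, if_true]
  ring

/-- There are exactly `L − 1` genuine bonds: `Σ_{i : Fin L} [i + 1 < L] c = (L − 1) c` (`L ≥ 1`). [folklore] -/
theorem sum_ite_succ_lt {L : ℕ} (hL : 1 ≤ L) (c : ℝ) :
    (∑ i : Fin L, if i.val + 1 < L then c else 0) = ((L : ℝ) - 1) * c := by
  cases L with
  | zero => exact absurd hL (by norm_num)
  | succ n =>
    rw [Fin.sum_univ_castSucc]
    have h1 : ∀ i : Fin n, ((if (Fin.castSucc i).val + 1 < n + 1 then c else 0 : ℝ)) = c := fun i => by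
      rw [if_pos]; simp [i.isLt]
    simp only [h1, Finset.sum_const, Finset.card_univ, Fintype.card_fin, nsmul_eq_mul, Fin.val_last,
      lt_self_iff_false, if_false, add_zero]
    push_cast
    ring

section Gibbs

variable (hω : 0 < ω₂) (hl : 0 ≤ lam) (hβ : 0 ≤ β) (γ : ℝ) {T : ℝ} (hT : 0 < T)
include hω hl hβ hT

/-! ### (M2) `L`-uniform local monomial moments -/

/-- **Uniform local monomial moments (M2), product form.** For an exponent bound `D`, `r₁` momentum factors and `r₂` position
factors there is `C = C(ω₂, lam, β, T, D, r₁, r₂)` such that for EVERY length `L`, all sites `km a`, `kq b` (repetitions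
allowed) and all exponents `em a, eq b ≤ D`, the absolute monomial `∏_a |p_{km a}|^{em a} · ∏_b |q_{kq b}|^{eq b}` is
`μ_T`-integrable with integral `≤ C` (`XY ≤ X² + Y²`, AM–GM through the maximum, `|y|^m ≤ 1 + y^{2n}`, and the uniform
even one-site moments of part I). [folklore] -/
theorem exists_integral_absMonomial_le (D r₁ r₂ : ℕ) : ∃ C : ℝ, 0 ≤ C ∧ ∀ (L : ℕ) (km : Fin r₁ → Fin L) (em : Fin r₁ → ℕ)
    (kq : Fin r₂ → Fin L) (eq : Fin r₂ → ℕ), (∀ a, em a ≤ D) → (∀ b, eq b ≤ D) →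
    Integrable (fun x : PhaseSpace L => (∏ a, |x.2 (km a)| ^ em a) * ∏ b, |x.1 (kq b)| ^ eq b)
        ((pinnedChain ω₂ lam β γ).gibbsMeasure L T) ∧
      ∫ x, (∏ a, |x.2 (km a)| ^ em a) * ∏ b, |x.1 (kq b)| ^ eq b ∂((pinnedChain ω₂ lam β γ).gibbsMeasure L T) ≤ C := by
  obtain ⟨Cq, hCq0, hCq⟩ := exists_integral_fst_even_pow_le hω hl hβ γ hT (2 * D * r₂)
  set Cp : ℝ := ((2 * (2 * D * r₁)).factorial : ℝ) * T ^ (2 * D * r₁) with hCp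
  have hCp0 : 0 ≤ Cp := by positivity
  refine ⟨(1 + r₁ * (1 + Cp)) + (1 + r₂ * (1 + Cq)), by positivity, fun L km em kq eq hem heq => ?_⟩
  set μ := (pinnedChain ω₂ lam β γ).gibbsMeasure L T with hμ
  haveI : IsProbabilityMeasure μ := pinnedChain_isProbabilityMeasure_gibbsMeasure hω hl hβ γ L hT
  -- the two half monomials and their even one-site majorants
  set X : PhaseSpace L → ℝ := fun x => ∏ a, |x.2 (km a)| ^ em a with hX
  set Y : PhaseSpace L → ℝ := fun x => ∏ b, |x.1 (kq b)| ^ eq b with hY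
  set GX : PhaseSpace L → ℝ := fun x => 1 + ∑ a, (1 + x.2 (km a) ^ (2 * (2 * D * r₁))) with hGX
  set GY : PhaseSpace L → ℝ := fun x => 1 + ∑ b, (1 + x.1 (kq b) ^ (2 * (2 * D * r₂))) with hGY
  have hX0 : ∀ x, 0 ≤ X x := fun x => Finset.prod_nonneg fun a _ => by positivity
  have hY0 : ∀ x, 0 ≤ Y x := fun x => Finset.prod_nonneg fun b _ => by positivity
  have hX2 : ∀ x, X x ^ 2 ≤ GX x := fun x => by
    have h := absMonomial_le (D := 2 * D) (fun a => x.2 (km a)) (fun a => 2 * em a) fun a => by linarith [hem a]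
    have e : X x ^ 2 = ∏ a, |x.2 (km a)| ^ (2 * em a) := by
      rw [hX, ← Finset.prod_pow]
      exact Finset.prod_congr rfl fun a _ => by rw [← pow_mul, mul_comm]
    rw [e]
    exact h
  have hY2 : ∀ x, Y x ^ 2 ≤ GY x := fun x => by
    have h := absMonomial_le (D := 2 * D) (fun b => x.1 (kq b)) (fun b => 2 * eq b) fun b => by linarith [heq b]
    have e : Y x ^ 2 = ∏ b, |x.1 (kq b)| ^ (2 * eq b) := by
      rw [hY, ← Finset.prod_pow]
      exact Finset.prod_congr rfl fun b _ => by rw [← pow_mul, mul_comm]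
    rw [e]
    exact h
  have hpt : ∀ x, X x * Y x ≤ GX x + GY x := fun x => by
    nlinarith [hX2 x, hY2 x, sq_nonneg (X x - Y x), hX0 x, hY0 x]
  -- integrability of the majorants and their integrals
  have hIp : ∀ a, Integrable (fun x : PhaseSpace L => 1 + x.2 (km a) ^ (2 * (2 * D * r₁))) μ := fun a =>
    (integrable_const _).add (integrable_snd_pow hω hl hβ γ hT L (km a) _)
  have hIq : ∀ b, Integrable (fun x : PhaseSpace L => 1 + x.1 (kq b) ^ (2 * (2 * D * r₂))) μ := fun b =>
    (integrable_const _).add (integrable_fst_pow hω hl hβ γ hT L (kq b) _)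
  have hIGX : Integrable GX μ := (integrable_const _).add (integrable_finsetSum _ fun a _ => hIp a)
  have hIGY : Integrable GY μ := (integrable_const _).add (integrable_finsetSum _ fun b _ => hIq b)
  have hGXle : ∫ x, GX x ∂μ ≤ 1 + r₁ * (1 + Cp) := by
    rw [hGX, integral_add (integrable_const _) (integrable_finsetSum _ fun a _ => hIp a),
      integral_finsetSum _ fun a _ => hIp a]
    simp only [integral_const, probReal_univ, smul_eq_mul, one_mul]
    have hterm : ∀ a, ∫ x, (1 + x.2 (km a) ^ (2 * (2 * D * r₁))) ∂μ ≤ 1 + Cp := fun a => by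
      rw [integral_add (integrable_const _) (integrable_snd_pow hω hl hβ γ hT L (km a) _)]
      simp only [integral_const, probReal_univ, smul_eq_mul, one_mul]
      linarith [integral_snd_even_pow_le hω hl hβ γ hT L (km a) (2 * D * r₁)]
    calc (1 : ℝ) + ∑ a, ∫ x, (1 + x.2 (km a) ^ (2 * (2 * D * r₁))) ∂μ ≤ 1 + ∑ _a : Fin r₁, (1 + Cp) :=
          add_le_add le_rfl (Finset.sum_le_sum fun a _ => hterm a)
      _ = 1 + r₁ * (1 + Cp) := by simp only [Finset.sum_const, Finset.card_univ, Fintype.card_fin, nsmul_eq_mul]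
  have hGYle : ∫ x, GY x ∂μ ≤ 1 + r₂ * (1 + Cq) := by
    rw [hGY, integral_add (integrable_const _) (integrable_finsetSum _ fun b _ => hIq b),
      integral_finsetSum _ fun b _ => hIq b]
    simp only [integral_const, probReal_univ, smul_eq_mul, one_mul]
    have hterm : ∀ b, ∫ x, (1 + x.1 (kq b) ^ (2 * (2 * D * r₂))) ∂μ ≤ 1 + Cq := fun b => by
      rw [integral_add (integrable_const _) (integrable_fst_pow hω hl hβ γ hT L (kq b) _)]
      simp only [integral_const, probReal_univ, smul_eq_mul, one_mul]
      linarith [hCq L (kq b)]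
    calc (1 : ℝ) + ∑ b, ∫ x, (1 + x.1 (kq b) ^ (2 * (2 * D * r₂))) ∂μ ≤ 1 + ∑ _b : Fin r₂, (1 + Cq) :=
          add_le_add le_rfl (Finset.sum_le_sum fun b _ => hterm b)
      _ = 1 + r₂ * (1 + Cq) := by simp only [Finset.sum_const, Finset.card_univ, Fintype.card_fin, nsmul_eq_mul]
  -- the monomial: continuous, dominated by `GX + GY`
  have hc : Continuous fun x : PhaseSpace L => X x * Y x :=
    (continuous_finsetProd _ fun a _ => (((continuous_apply (km a)).comp continuous_snd).abs.pow _)).mul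
      (continuous_finsetProd _ fun b _ => (((continuous_apply (kq b)).comp continuous_fst).abs.pow _))
  have hI : Integrable (fun x => X x * Y x) μ :=
    (hIGX.add hIGY).mono' hc.aestronglyMeasurable (ae_of_all _ fun x => by
      rw [Real.norm_eq_abs, abs_of_nonneg (mul_nonneg (hX0 x) (hY0 x))]
      exact hpt x)
  refine ⟨hI, ?_⟩
  calc ∫ x, X x * Y x ∂μ ≤ ∫ x, (GX x + GY x) ∂μ := integral_mono hI (hIGX.add hIGY) hpt
    _ = (∫ x, GX x ∂μ) + ∫ x, GY x ∂μ := integral_add hIGX hIGY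
    _ ≤ _ := add_le_add hGXle hGYle

/-- **Uniform local monomial moments (M2), six explicit factors.** For an exponent bound `D` there is
`C = C(ω₂, lam, β, T, D)` such that for EVERY `L`, all sites `k, l, m, k', l', m'` (any, possibly equal) and all exponents
`a, …, f ≤ D`: `|p_k|^a |p_l|^b |p_m|^c |q_{k'}|^d |q_{l'}|^e |q_{m'}|^f ∈ L¹(μ_T)` with `∫ (·) dμ_T ≤ C` (set unused exponents
to `0`). [folklore] -/
theorem exists_integral_absMonomial₆_le (D : ℕ) : ∃ C : ℝ, 0 ≤ C ∧ ∀ (L : ℕ) (k l m k' l' m' : Fin L) (a b c d e f : ℕ),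
    a ≤ D → b ≤ D → c ≤ D → d ≤ D → e ≤ D → f ≤ D →
    Integrable (fun x : PhaseSpace L =>
        |x.2 k| ^ a * |x.2 l| ^ b * |x.2 m| ^ c * |x.1 k'| ^ d * |x.1 l'| ^ e * |x.1 m'| ^ f)
        ((pinnedChain ω₂ lam β γ).gibbsMeasure L T) ∧
      ∫ x, |x.2 k| ^ a * |x.2 l| ^ b * |x.2 m| ^ c * |x.1 k'| ^ d * |x.1 l'| ^ e * |x.1 m'| ^ f
        ∂((pinnedChain ω₂ lam β γ).gibbsMeasure L T) ≤ C := by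
  obtain ⟨C, hC0, hC⟩ := exists_integral_absMonomial_le hω hl hβ γ hT D 3 3
  refine ⟨C, hC0, fun L k l m k' l' m' a b c d e f ha hb hc hd he hf => ?_⟩
  have h := hC L ![k, l, m] ![a, b, c] ![k', l', m'] ![d, e, f]
    (fun i => by fin_cases i <;> assumption) (fun i => by fin_cases i <;> assumption)
  simp only [Fin.prod_univ_three, Matrix.cons_val_zero, Matrix.cons_val_one, Matrix.cons_val_two, mul_assoc] at h
  simp only [mul_assoc]
  exact h

/-- **`L²(μ_T)` membership of local monomials** (fixed `L`, no uniformity): every product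
`|p_k|^a |p_l|^b |p_m|^c |q_{k'}|^d |q_{l'}|^e |q_{m'}|^f` is in `L²(μ_T)`. [folklore] -/
theorem memLp_two_absMonomial₆ (L : ℕ) (k l m k' l' m' : Fin L) (a b c d e f : ℕ) :
    MemLp (fun x : PhaseSpace L => |x.2 k| ^ a * |x.2 l| ^ b * |x.2 m| ^ c * |x.1 k'| ^ d * |x.1 l'| ^ e * |x.1 m'| ^ f) 2
      ((pinnedChain ω₂ lam β γ).gibbsMeasure L T) := by
  have hc : Continuous fun x : PhaseSpace L =>
      |x.2 k| ^ a * |x.2 l| ^ b * |x.2 m| ^ c * |x.1 k'| ^ d * |x.1 l'| ^ e * |x.1 m'| ^ f := by fun_prop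
  rw [memLp_two_iff_integrable_sq hc.aestronglyMeasurable]
  obtain ⟨C, -, hC⟩ := exists_integral_absMonomial₆_le hω hl hβ γ hT (2 * (a + b + c + d + e + f))
  have h := (hC L k l m k' l' m' (2 * a) (2 * b) (2 * c) (2 * d) (2 * e) (2 * f) (by omega) (by omega) (by omega)
    (by omega) (by omega) (by omega)).1
  refine h.congr (ae_of_all _ fun x => ?_)
  simp only [pow_mul']
  ring

/-- **(M2), two momenta and two positions**: `∫ |p_k|^a |p_l|^b |q_{k'}|^c |q_{l'}|^d dμ_T ≤ C(D)` uniformly in `L` and the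
sites, for all exponents `≤ D`. [folklore] -/
theorem exists_integral_absMonomial₂₂_le (D : ℕ) : ∃ C : ℝ, 0 ≤ C ∧ ∀ (L : ℕ) (k l k' l' : Fin L) (a b c d : ℕ),
    a ≤ D → b ≤ D → c ≤ D → d ≤ D →
    Integrable (fun x : PhaseSpace L => |x.2 k| ^ a * |x.2 l| ^ b * |x.1 k'| ^ c * |x.1 l'| ^ d)
        ((pinnedChain ω₂ lam β γ).gibbsMeasure L T) ∧
      ∫ x, |x.2 k| ^ a * |x.2 l| ^ b * |x.1 k'| ^ c * |x.1 l'| ^ d ∂((pinnedChain ω₂ lam β γ).gibbsMeasure L T) ≤ C := by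
  obtain ⟨C, hC0, hC⟩ := exists_integral_absMonomial₆_le hω hl hβ γ hT D
  refine ⟨C, hC0, fun L k l k' l' a b c d ha hb hc hd => ?_⟩
  simpa using hC L k l k k' l' k' a b 0 c d 0 ha hb (Nat.zero_le _) hc hd (Nat.zero_le _)

/-- **(M2), one momentum and three positions**: `∫ |p_k|^a |q_{k'}|^c |q_{l'}|^d |q_{m'}|^e dμ_T ≤ C(D)` uniformly in `L` and
the sites, for all exponents `≤ D`. [folklore] -/
theorem exists_integral_absMonomial₁₃_le (D : ℕ) : ∃ C : ℝ, 0 ≤ C ∧ ∀ (L : ℕ) (k k' l' m' : Fin L) (a c d e : ℕ),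
    a ≤ D → c ≤ D → d ≤ D → e ≤ D →
    Integrable (fun x : PhaseSpace L => |x.2 k| ^ a * |x.1 k'| ^ c * |x.1 l'| ^ d * |x.1 m'| ^ e)
        ((pinnedChain ω₂ lam β γ).gibbsMeasure L T) ∧
      ∫ x, |x.2 k| ^ a * |x.1 k'| ^ c * |x.1 l'| ^ d * |x.1 m'| ^ e ∂((pinnedChain ω₂ lam β γ).gibbsMeasure L T) ≤ C := by
  obtain ⟨C, hC0, hC⟩ := exists_integral_absMonomial₆_le hω hl hβ γ hT D
  refine ⟨C, hC0, fun L k k' l' m' a c d e ha hc hd he => ?_⟩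
  simpa using hC L k k k k' l' m' a 0 0 c d e ha (Nat.zero_le _) (Nat.zero_le _) hc hd he

/-! ### (M4) The three numbers of the Thomson-witness project -/

/-- `E_{≤i}` is continuous with `|E_{≤i}| ≤ (1 + H)`, hence `E_{≤i} p_b^m ∈ L¹(μ_T)` for all `b`, `m`. [folklore] -/
theorem integrable_leftEnergy_mul_snd_pow (L : ℕ) (i b : Fin L) (m : ℕ) :
    Integrable (fun x => leftEnergy (pinnedChain ω₂ lam β γ) L i x * x.2 b ^ m)
      ((pinnedChain ω₂ lam β γ).gibbsMeasure L T) := by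
  set P := pinnedChain ω₂ lam β γ with hP
  have hU0 : ∀ q, 0 ≤ P.U q := fun q => by
    show 0 ≤ ω₂ * q ^ 2 / 2 + lam * q ^ 4 / 4
    positivity
  have hV0 : ∀ r, 0 ≤ P.V r := fun r => by
    show 0 ≤ r ^ 2 / 2 + β * r ^ 4 / 4
    positivity
  refine integrable_mul_snd_pow_of_abs_le hω hl hβ γ hT L
    (contDiff_leftEnergy' P (pinnedChain_contDiff_U ω₂ lam β γ (n := 0)) (pinnedChain_contDiff_V ω₂ lam β γ) L i).continuous
    (C := 1) (n := 1) (fun x => ?_) b m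
  obtain ⟨h0, h1⟩ := leftEnergy_mem_Icc P hU0 hV0 L i x
  rw [abs_of_nonneg h0, pow_one, one_mul]
  linarith

/-- **(M4a) The pattern term has a constant second moment**: for `i0 ≠ iL`, `∫ (p_{i0}² − p_{iL}²)² dμ_T = 4T²`
(`= 3T² − 2T² + 3T²`; two independent `N(0,T)` momenta). [folklore] -/
theorem integral_sq_sub_sq_sq (L : ℕ) {i0 iL : Fin L} (h : i0 ≠ iL) :
    ∫ x, (x.2 i0 ^ 2 - x.2 iL ^ 2) ^ 2 ∂((pinnedChain ω₂ lam β γ).gibbsMeasure L T) = 4 * T ^ 2 := by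
  have e1 := integral_snd_pow_four hω hl hβ γ hT L i0
  have e2 := integral_snd_pow_four hω hl hβ γ hT L iL
  have e3 := integral_snd_sq_mul_snd_sq hω hl hβ γ hT L h
  have i4 := fun b : Fin L => integrable_snd_pow hω hl hβ γ hT L b 4
  have i22 : Integrable (fun x : PhaseSpace L => x.2 iL ^ 2 * x.2 i0 ^ 2) ((pinnedChain ω₂ lam β γ).gibbsMeasure L T) :=
    integrable_mul_snd_pow_of_abs_le hω hl hβ γ hT L (g := fun z : PhaseSpace L => z.2 iL ^ 2) (by fun_prop)
      (fun x => pinnedChain_abs_momentum_pow_le_all hω hl hβ γ L x iL 2) i0 2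
  have hpt : ∀ x : PhaseSpace L, (x.2 i0 ^ 2 - x.2 iL ^ 2) ^ 2 =
      x.2 i0 ^ 4 + x.2 iL ^ 4 - 2 * (x.2 iL ^ 2 * x.2 i0 ^ 2) := fun x => by ring
  simp_rw [hpt]
  rw [integral_sub ((i4 i0).fun_add (i4 iL)) (i22.const_mul 2), integral_add (i4 i0) (i4 iL), integral_const_mul,
    e1, e2, e3]
  ring

/-- **(M4b) Bond pairing**: for `L ≥ 2` and every genuine bond `i` (`i + 1 < L`),
`∫ E_{≤i} (p_0² − p_{L−1}²) dμ_T = T²`. Indeed `E_{≤i} = p_0²/2 + W` with `W` independent of `p_0` and of `p_{L−1}`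
(the block `{k ≤ i}` contains site `0` and not site `L − 1`), so `∫ E_{≤i} p_0² = 3T²/2 + T∫W` and
`∫ E_{≤i} p_{L−1}² = T²/2 + T∫W`. [folklore] -/
theorem integral_leftEnergy_mul_sq_sub_sq {L : ℕ} (hL : 2 ≤ L) {i : Fin L} (hi : i.val + 1 < L) :
    ∫ x, leftEnergy (pinnedChain ω₂ lam β γ) L i x * (x.2 ⟨0, by omega⟩ ^ 2 - x.2 ⟨L - 1, by omega⟩ ^ 2)
      ∂((pinnedChain ω₂ lam β γ).gibbsMeasure L T) = T ^ 2 := by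
  set P := pinnedChain ω₂ lam β γ with hP
  set i0 : Fin L := ⟨0, by omega⟩ with hi0
  set iL : Fin L := ⟨L - 1, by omega⟩ with hiL
  have h0L : i0 ≠ iL := by
    intro h
    have := congrArg Fin.val h
    simp only [hi0, hiL] at this
    omega
  have hw0 : blockWeight i i0 = 1 := if_pos (Nat.zero_le _)
  have hwL : blockWeight i iL = 0 := if_neg (by simp only [hiL]; omega)
  set W : PhaseSpace L → ℝ := fun x => leftEnergy P L i x - x.2 i0 ^ 2 / 2 with hW
  have hW0 : ∀ (x : PhaseSpace L) (t : ℝ), W (x.1, Function.update x.2 i0 t) = W x := fun x t => by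
    simp only [hW, leftEnergy_update_snd, hw0, Function.update_self]
    ring
  have hWL : ∀ (x : PhaseSpace L) (t : ℝ), W (x.1, Function.update x.2 iL t) = W x := fun x t => by
    simp only [hW, leftEnergy_update_snd, hwL, Function.update_of_ne h0L]
    ring
  have hWI : ∀ (b : Fin L) (m : ℕ), Integrable (fun x => W x * x.2 b ^ m) (P.gibbsMeasure L T) := fun b m => by
    have h2 : Integrable (fun x : PhaseSpace L => x.2 i0 ^ 2 / 2 * x.2 b ^ m) (P.gibbsMeasure L T) :=
      integrable_mul_snd_pow_of_abs_le hω hl hβ γ hT L (g := fun z : PhaseSpace L => z.2 i0 ^ 2 / 2) (by fun_prop)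
        (C := 2 ^ 2) (n := 2) (fun x => by
          have := pinnedChain_abs_momentum_pow_le_all hω hl hβ γ L x i0 2
          rw [abs_div, abs_two]
          linarith [abs_nonneg (x.2 i0 ^ 2)]) b m
    exact ((integrable_leftEnergy_mul_snd_pow hω hl hβ γ hT L i b m).sub h2).congr
      (ae_of_all _ fun x => by simp only [hW, Pi.sub_apply]; ring)
  have eW0 := integral_indep_mul_snd_sq hω hl hβ γ hT L i0 hW0 (by simpa using hWI i0 0) (by simpa using hWI i0 1)
    (hWI i0 2)
  have eWL := integral_indep_mul_snd_sq hω hl hβ γ hT L iL hWL (by simpa using hWI iL 0) (by simpa using hWI iL 1)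
    (hWI iL 2)
  have e4 := integral_snd_pow_four hω hl hβ γ hT L i0
  have e22 := integral_snd_sq_mul_snd_sq hω hl hβ γ hT L h0L
  have i4 := integrable_snd_pow hω hl hβ γ hT L i0 4
  have i22 : Integrable (fun x : PhaseSpace L => x.2 iL ^ 2 * x.2 i0 ^ 2) (P.gibbsMeasure L T) :=
    integrable_mul_snd_pow_of_abs_le hω hl hβ γ hT L (g := fun z : PhaseSpace L => z.2 iL ^ 2) (by fun_prop)
      (fun x => pinnedChain_abs_momentum_pow_le_all hω hl hβ γ L x iL 2) i0 2
  have hpt : ∀ x : PhaseSpace L, leftEnergy P L i x * (x.2 i0 ^ 2 - x.2 iL ^ 2) =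
      (x.2 i0 ^ 4 / 2 + W x * x.2 i0 ^ 2) - (x.2 iL ^ 2 * x.2 i0 ^ 2 / 2 + W x * x.2 iL ^ 2) := fun x => by
    simp only [hW]; ring
  rw [integral_congr_ae (ae_of_all _ hpt),
    integral_sub ((i4.div_const 2).fun_add (hWI i0 2)) ((i22.div_const 2).fun_add (hWI iL 2)),
    integral_add (i4.div_const 2) (hWI i0 2), integral_add (i22.div_const 2) (hWI iL 2),
    integral_div, integral_div, e4, e22, eW0, eWL]
  ring

/-- **(M4c) Block pairing summed over the bonds**: for `L ≥ 2`,
`∫ (Σ_i [i + 1 < L] E_{≤i}) (p_0² − p_{L−1}²) dμ_T = (L − 1) T²` (there are `L − 1` genuine bonds). [folklore] -/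
theorem integral_blockEnergySum_mul_sq_sub_sq {L : ℕ} (hL : 2 ≤ L) :
    ∫ x, (∑ i : Fin L, if i.val + 1 < L then leftEnergy (pinnedChain ω₂ lam β γ) L i x else 0) *
        (x.2 ⟨0, by omega⟩ ^ 2 - x.2 ⟨L - 1, by omega⟩ ^ 2) ∂((pinnedChain ω₂ lam β γ).gibbsMeasure L T) =
      ((L : ℝ) - 1) * T ^ 2 := by
  set P := pinnedChain ω₂ lam β γ with hP
  set i0 : Fin L := ⟨0, by omega⟩ with hi0
  set iL : Fin L := ⟨L - 1, by omega⟩ with hiL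
  have hI : ∀ i : Fin L, Integrable (fun x => (if i.val + 1 < L then leftEnergy P L i x else 0) *
      (x.2 i0 ^ 2 - x.2 iL ^ 2)) (P.gibbsMeasure L T) := by
    intro i
    by_cases hi : i.val + 1 < L
    · simp only [if_pos hi, mul_sub]
      exact (integrable_leftEnergy_mul_snd_pow hω hl hβ γ hT L i i0 2).sub
        (integrable_leftEnergy_mul_snd_pow hω hl hβ γ hT L i iL 2)
    · simp only [if_neg hi, zero_mul]
      exact integrable_zero _ _ _
  have hterm : ∀ i : Fin L, ∫ x, (if i.val + 1 < L then leftEnergy P L i x else 0) * (x.2 i0 ^ 2 - x.2 iL ^ 2)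
      ∂(P.gibbsMeasure L T) = if i.val + 1 < L then T ^ 2 else 0 := by
    intro i
    split_ifs with hi
    · exact integral_leftEnergy_mul_sq_sub_sq hω hl hβ γ hT hL hi
    · simp
  calc ∫ x, (∑ i : Fin L, if i.val + 1 < L then leftEnergy P L i x else 0) * (x.2 i0 ^ 2 - x.2 iL ^ 2)
        ∂(P.gibbsMeasure L T)
      = ∫ x, ∑ i : Fin L, (if i.val + 1 < L then leftEnergy P L i x else 0) * (x.2 i0 ^ 2 - x.2 iL ^ 2)
          ∂(P.gibbsMeasure L T) := integral_congr_ae (ae_of_all _ fun x => by simp only [Finset.sum_mul])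
    _ = ∑ i : Fin L, ∫ x, (if i.val + 1 < L then leftEnergy P L i x else 0) * (x.2 i0 ^ 2 - x.2 iL ^ 2)
          ∂(P.gibbsMeasure L T) := integral_finsetSum _ fun i _ => hI i
    _ = ∑ i : Fin L, (if i.val + 1 < L then T ^ 2 else 0) := Finset.sum_congr rfl fun i _ => hterm i
    _ = ((L : ℝ) - 1) * T ^ 2 := sum_ite_succ_lt (by omega) _

end Gibbs

/-! ## Registered helpers (notation-free restatements) -/

/-- Registered helper `helper_thomsonMomentsAbsMonomial` (W4/M2) of stub B `stub_bulkAbelGKPositivity`, line `abel-storage-decay`,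
crux stmt-AtomisticToContinuum-11977: `L`-uniform bound on the Gibbs integral of every six-factor absolute local monomial
`|p_k|^a |p_l|^b |p_m|^c |q_{k'}|^d |q_{l'}|^e |q_{m'}|^f` with exponents `≤ D` (`exists_integral_absMonomial₆_le`). [folklore] -/
theorem helper_thomsonMomentsAbsMonomial : ∀ (ω₂ lam β γ T : ℝ), 0 < ω₂ → 0 < lam → 0 < β → 0 < T → ∀ (D : ℕ), ∃ C : ℝ, 0 ≤ C ∧ ∀ (L : ℕ) (k l m k' l' m' : Fin L) (a b c d e f : ℕ), a ≤ D → b ≤ D → c ≤ D → d ≤ D → e ≤ D → f ≤ D → MeasureTheory.Integrable (fun x : Literature.MathematicalPhysics.KineticTheory.HeatConduction.PhaseSpace L => |x.2 k| ^ a * |x.2 l| ^ b * |x.2 m| ^ c * |x.1 k'| ^ d * |x.1 l'| ^ e * |x.1 m'| ^ f) ((Literature.MathematicalPhysics.KineticTheory.HeatConduction.pinnedChain ω₂ lam β γ).gibbsMeasure L T) ∧ MeasureTheory.integral ((Literature.MathematicalPhysics.KineticTheory.HeatConduction.pinnedChain ω₂ lam β γ).gibbsMeasure L T) (fun x => |x.2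 k| ^ a * |x.2 l| ^ b * |x.2 m| ^ c * |x.1 k'| ^ d * |x.1 l'| ^ e * |x.1 m'| ^ f) ≤ C :=
  fun _ _ _ γ _ hω hl hβ hT D => exists_integral_absMonomial₆_le hω hl.le hβ.le γ hT D

/-- Registered helper `helper_thomsonMomentsPatternSq` (W4/M4a) of stub B `stub_bulkAbelGKPositivity`, line `abel-storage-decay`,
crux stmt-AtomisticToContinuum-11977: `∫ (p_0² − p_{L−1}²)² dμ_T = 4T²` for `L ≥ 2` (`integral_sq_sub_sq_sq`). [folklore] -/
theorem helper_thomsonMomentsPatternSq : ∀ (ω₂ lam β γ T : ℝ), 0 < ω₂ → 0 < lam → 0 < β → 0 < T → ∀ (L : ℕ) (hL : 2 ≤ L), MeasureTheory.integral ((Literature.MathematicalPhysics.KineticTheory.HeatConduction.pinnedChain ω₂ lam β γ).gibbsMeasure L T) (fun x => (x.2 ⟨0, by omega⟩ ^ 2 - x.2 ⟨L - 1, by omega⟩ ^ 2) ^ 2) = 4 * T ^ 2 := by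
  intro ω₂ lam β γ T hω hl hβ hT L hL
  refine integral_sq_sub_sq_sq hω hl.le hβ.le γ hT L fun h => ?_
  have := congrArg Fin.val h
  simp only at this
  omega

/-- Registered helper `helper_thomsonMomentsBondPairing` (W4/M4b): for `L ≥ 2` and every genuine bond `i`,
`∫ E_{≤i} (p_0² − p_{L−1}²) dμ_T = T²` (`integral_leftEnergy_mul_sq_sub_sq`). [folklore] -/
theorem helper_thomsonMomentsBondPairing : ∀ (ω₂ lam β γ T : ℝ), 0 < ω₂ → 0 < lam → 0 < β → 0 < T → ∀ (L : ℕ) (hL : 2 ≤ L) (i : Fin L), i.val + 1 < L → MeasureTheory.integral ((Literature.MathematicalPhysics.KineticTheory.HeatConduction.pinnedChain ω₂ lam β γ).gibbsMeasure L T) (fun x => Literature.MathematicalPhysics.KineticTheory.HeatConduction.HardTether.leftEnergy (Literature.MathematicalPhysics.KineticTheory.HeatConduction.pinnedChain ω₂ lam β γ) L i x * (x.2 ⟨0, by omega⟩ ^ 2 - x.2 ⟨L - 1, by omega⟩ ^ 2)) = T ^ 2 :=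
  fun _ _ _ γ _ hω hl hβ hT _ hL _ hi => integral_leftEnergy_mul_sq_sub_sq hω hl.le hβ.le γ hT hL hi

/-- Registered helper `helper_thomsonMomentsBlockPairing` (W4/M4c): for `L ≥ 2`,
`∫ (Σ_i [i + 1 < L] E_{≤i}) (p_0² − p_{L−1}²) dμ_T = (L − 1)T²` (`integral_blockEnergySum_mul_sq_sub_sq`). [folklore] -/
theorem helper_thomsonMomentsBlockPairing : ∀ (ω₂ lam β γ T : ℝ), 0 < ω₂ → 0 < lam → 0 < β → 0 < T → ∀ (L : ℕ) (hL : 2 ≤ L), MeasureTheory.integral ((Literature.MathematicalPhysics.KineticTheory.HeatConduction.pinnedChain ω₂ lam β γ).gibbsMeasure L T) (fun x => (∑ i : Fin L, if i.val + 1 < L then Literature.MathematicalPhysics.KineticTheory.HeatConduction.HardTether.leftEnergy (Literature.MathematicalPhysics.KineticTheory.HeatConduction.pinnedChain ω₂ lam β γ) L i x else 0) * (x.2 ⟨0, by omega⟩ ^ 2 - x.2 ⟨L - 1, by omega⟩ ^ 2)) = ((L : ℝ) - 1) * T ^ 2 :=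
  fun _ _ _ γ _ hω hl hβ hT _ hL => integral_blockEnergySum_mul_sq_sub_sq hω hl.le hβ.le γ hT hL

end Summit.AtomisticToContinuum.FouriersLaw.Theorems.NoisyFourier.ThomsonWitness.Moments

end
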